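import Summits.QuantumFields.YangMills.Theorems.BalabanUVNodesN15BackgroundVWordsByName
import Summits.QuantumFields.YangMills.Theorems.BalabanUVNodesN15BackgroundV1GaugeByName
import HarnessLib

/-!
# Route «BalabanUVNodes» (cluster K4 «SpineRates»), Track-A DAG node N15 = spine estimate NE2, BACKGROUND LAYER — `T4EtaRate.NE2PlusOperator` BY NAME WITH THE
# (3.60)-SHAPED FULL PERTURBATION `V′(A) = V′₁(A) − W(A)` LIVE, for ANY block-local zeroth-order species `W` with the (3.59)-shape sup letter and a two-spacing
# fit letter: the node theorems over the `V′₁` triple carrier and over the gauge carrier (the gauge field `A′` itself the datum)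

Cell `pub-ymgap`, seat `pub-ymgap-dag-n15-c` (generation g4; R134 ACCELERATION SEAT, strategy s1 «background-layer OPERATOR ingredient»; HUMAN RULING D-0062; chair
R424 venue).  `bears_on: R4∕N15`.  Filed `--supports stmt-QuantumFields-19908 --as helper` (K3′; helper).  Imports BY NAME, nothing in the tree modified: this seat's
`…N15BackgroundVWordsByName` (`vWOps4`, `gVWc35`, `le_gVWc35`, `etaRateIneq342_vWEntries`; through it V1b∕V2 `v1Bg`, `v1Instance`, n15-b `bgConst`∕`bgConst1`,
`one_le_pref4`, g0 `opGeo`∕`opFamily`) and (V4) `…N15BackgroundV1GaugeByName` (`v1GaugeBg`, `v1GaugeInstance`, `v1fieldsOfGauge`, `reg335_fields_of_gauge`).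

THE POINT.  V2's `ne2PlusOperator_v1` and (V4)'s `ne2PlusOperator_v1G` read `NE2PlusOperator` out by name with the print's `V′₁(A)` of (3.52) live; the print's
perturbation is the FULL `V′(A)` of [Balaban1985BackgroundPropagators] (3.60) p. 402, `V′₁(A)` minus the three block-local AVERAGING WORDS.  With
`etaRateIneq342_vWEntries` (any block-local species `W` with letters `≤ diagK (c_W·c₃₅Mα₀)` (sup, both spacings) and `≤ diagK (c_W·c₃₅Mα₀·θ)` (two-spacing fit))
the same readouts hold for the kernel families whose perturbation is `V̂₁ − W∘pr_none`: THIS FILE states them — species data `Wc i U` (coarse word) and `Wf i U`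
(fine word) as functions of the configuration, their two letters DISPLAYED as hypotheses quantified over the (3.35)-regular configurations (the print's (3.59)
«|(F′₂ⱼ(A)λ)(y)| ≤ O(1)α₁(Q′ⱼ|λ|)(y)» is the model of the sup letter; the fit letter is NOT PRINTED).  (V5)'s `avgWord` with `hasMaj_avgWord`∕`hasMaj_idef_avgWord`
(block mean CONCRETE, `F₂` abstract) discharges both letters from letters on `F₂`, `F₂*` alone under uniform pairing fibres — the realised vector piece is the sequel.

CONTENTS ([folklore] bookkeeping; 2 defs).
* §1 `vWFamily4` (the kernel family over V1b's triple carrier `v1Instance` with ops `vWOps4 id Wc Wf`); **`ne2PlusOperator_vW`** (`M₅ = 1`,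
  `a₀ = (2·gVWc35·(βc_r + 1))⁻¹`, `B₀ = bgConst + bgConst1 + 1` at `gVWc35`, `δ₀ = δ − σ`).
* §2 `vWGFamily4` (over (V4)'s gauge carrier `v1GaugeInstance`, ops `vWOps4 (v1fieldsOfGauge s′ η′) Wc Wf`); **`ne2PlusOperator_vWG`** (inside: `reg335_fields_of_gauge` at
  `c′ = (1+|J|)(1+C₀)c₃₅`, the species letters moved from `c₃₅` to `c′` by monotonicity, then `etaRateIneq342_vWEntries`).

HONEST FRAMING ∕ LIMITS.  SHAPES of (3.52) + (3.60) in the `U ≡ 1` background; the species `W` and its two letters are DISPLAYED (the print's `F′₂ⱼ(A)` of (3.55)–(3.58)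
NOT constructed; fit letter NOT PRINTED); fibrewise-mean transport (linearised (C3)); the coarse triple is the mean of the fine triple; `𝔤 ↦ 𝔄` with coordinates; the
`U ≡ 1` layer on `J ⊕ J` DISPLAYED; crude constants; nothing about Bałaban's `G(U)` asserted.  NE2⁺ NOT PRINTED, NOT proved; count-neutral (typed 28∕28; nothing
discharged); N15 NOT discharged; one finite lattice at fixed ε — NOT infinite volume, NOT OS on ℝ⁴, NOT a mass gap, NOT Clay.
-/

noncomputable section

open scoped BigOperators

namespace Summit.QuantumFields.YangMills.BalabanUVNodes.N15.BackgroundLayer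

open Literature.MathematicalPhysics.QuantumFieldTheory.Balaban1983to89
open Literature.MathematicalPhysics.QuantumFieldTheory.Balaban1983to89.B11SectG (BlockNorm HasMaj RowSum)
open Literature.MathematicalPhysics.QuantumFieldTheory.Balaban1983to89.T4EtaRate (PairedInstance NE2PlusOperator rateFactor)
open Literature.MathematicalPhysics.QuantumFieldTheory.Balaban1983to89.T4EtaRateDefect (idef rateWeight)
open Literature.MathematicalPhysics.QuantumFieldTheory.Balaban1983to89.T4EtaRateCoeffDefect (pull diagK diagK_mono)
open Literature.MathematicalPhysics.QuantumFieldTheory.Balaban1983to89.B6RandomWalk (Triangle254)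
open Summit.QuantumFields.YangMills.BalabanUVNodes.N15.OperatorReadout (opGeo opFamily opGeo_len)
open Summit.QuantumFields.YangMills.BalabanUVNodes.N15.MatrixSpecies (liftMap liftBlk basisConst basisConst_nonneg)

/-! ## §1 The triple carrier: `NE2PlusOperator` with `V′₁(A⁺, A⁻, W_div) − W` live -/

section Family

variable {X X' J ι : Type} [Fintype X] [Fintype X'] [Fintype J] [Fintype ι] [DecidableEq X] [DecidableEq X'] [DecidableEq J] [DecidableEq ι]
  {𝔄 : Type} [NormedRing 𝔄] [NormedAlgebra ℝ 𝔄] [CompleteSpace 𝔄] (e : 𝔄 ≃L[ℝ] (ι → ℝ)) {g : B6.Geometry} (blk : X → g.Site) (π : X' → X)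

/-- THE KERNEL FAMILY over the `V′₁` triple carriers with the full perturbation: ops `vWOps4 id Wc Wf` (spacings `η = g.eta`, `η′ = η·(L^n)⁻¹`).
[cite: Balaban1985BackgroundPropagators, (3.42) p.397, (3.60) p.402 (shapes)] -/
def vWFamily4 (Wc : (J → X' → 𝔄) × (J → X' → 𝔄) × (X' → 𝔄) → ((X × ι → ℝ) →ₗ[ℝ] (X × ι → ℝ)))
    (Wf : (J → X' → 𝔄) × (J → X' → 𝔄) × (X' → 𝔄) → ((X' × ι → ℝ) →ₗ[ℝ] (X' × ι → ℝ))) (n : ℕ) (hL : g.L ≠ 0) (θc θ : ℝ) (ν : J ⊕ J)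
    (G S D₃ : (X × ι → ℝ) →ₗ[ℝ] (X × ι → ℝ)) (D SD : J ⊕ J → (X × ι → ℝ) →ₗ[ℝ] (X × ι → ℝ)) (G' S' D₃' : (X' × ι → ℝ) →ₗ[ℝ] (X' × ι → ℝ))
    (D' SD' : J ⊕ J → (X' × ι → ℝ) →ₗ[ℝ] (X' × ι → ℝ)) :
    B9.KernelFamily (v1Instance 𝔄 J ι blk π n hL θc θ).gc (v1Instance 𝔄 J ι blk π n hL θc θ).Bf :=
  show B9.KernelFamily (opGeo g (X × ι) (liftBlk blk ι)) (v1Bg 𝔄 J π g.M θ) from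
    opFamily (g := g) (B := v1Bg 𝔄 J π g.M θ) (liftBlk blk ι) (liftBlk (blk ∘ π) ι)
      (vWOps4 e π (fun U => U) Wc Wf g.eta (g.eta * (g.L ^ n)⁻¹) ν G S D₃ D SD G' S' D₃' D' SD')

/-- THE KERNEL FAMILY over the gauge carriers with the full perturbation: ops `vWOps4 (v1fieldsOfGauge s′ η′) Wc Wf` (the `V′₁` triple DERIVED from `A′`, the words at `A′`).
[cite: Balaban1985BackgroundPropagators, (3.42) p.397, (3.52) p.400, (3.60) p.402 (shapes)] -/
def vWGFamily4 (Wc : (J → X' → 𝔄) → ((X × ι → ℝ) →ₗ[ℝ] (X × ι → ℝ))) (Wf : (J → X' → 𝔄) → ((X' × ι → ℝ) →ₗ[ℝ] (X' × ι → ℝ)))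
    (s : J → X ≃ X) (s' : J → X' ≃ X') (n : ℕ) (hL : g.L ≠ 0) (ν : J ⊕ J)
    (G S D₃ : (X × ι → ℝ) →ₗ[ℝ] (X × ι → ℝ)) (D SD : J ⊕ J → (X × ι → ℝ) →ₗ[ℝ] (X × ι → ℝ)) (G' S' D₃' : (X' × ι → ℝ) →ₗ[ℝ] (X' × ι → ℝ))
    (D' SD' : J ⊕ J → (X' × ι → ℝ) →ₗ[ℝ] (X' × ι → ℝ)) :
    B9.KernelFamily (v1GaugeInstance 𝔄 J ι blk π s s' n hL).gc (v1GaugeInstance 𝔄 J ι blk π s s' n hL).Bf :=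
  show B9.KernelFamily (opGeo g (X × ι) (liftBlk blk ι)) (v1GaugeBg 𝔄 J s' (g.eta * (g.L ^ n)⁻¹) g.M) from
    opFamily (g := g) (B := v1GaugeBg 𝔄 J s' (g.eta * (g.L ^ n)⁻¹) g.M) (liftBlk blk ι) (liftBlk (blk ∘ π) ι)
      (vWOps4 e π (v1fieldsOfGauge 𝔄 J s' (g.eta * (g.L ^ n)⁻¹)) Wc Wf g.eta (g.eta * (g.L ^ n)⁻¹) ν G S D₃ D SD G' S' D₃' D' SD')

end Family

section Node

variable {I J ι : Type} [Fintype J] [DecidableEq J] [Fintype ι] [DecidableEq ι] {𝔄 : Type} [NormedRing 𝔄] [NormedAlgebra ℝ 𝔄] [CompleteSpace 𝔄]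
  (e : 𝔄 ≃L[ℝ] (ι → ℝ)) (g : I → B6.Geometry) (X X' : I → Type) [∀ i, Fintype (X i)] [∀ i, Fintype (X' i)] [∀ i, DecidableEq (X i)]
  [∀ i, DecidableEq (X' i)] (blk : ∀ i, X i → (g i).Site) (π : ∀ i, X' i → X i) (nsh : I → ℕ) (hL0 : ∀ i, (g i).L ≠ 0) (θc θ : I → ℝ) (ν : I → J ⊕ J)
  (G S D₃ : ∀ i, (X i × ι → ℝ) →ₗ[ℝ] (X i × ι → ℝ)) (D SD : ∀ i, J ⊕ J → (X i × ι → ℝ) →ₗ[ℝ] (X i × ι → ℝ))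
  (G' S' D₃' : ∀ i, (X' i × ι → ℝ) →ₗ[ℝ] (X' i × ι → ℝ)) (D' SD' : ∀ i, J ⊕ J → (X' i × ι → ℝ) →ₗ[ℝ] (X' i × ι → ℝ))

/-- **NE2⁺, OPERATOR LAYER — `T4EtaRate.NE2PlusOperator` BY NAME WITH THE (3.60)-SHAPED FULL PERTURBATION `V′₁(A⁺, A⁻, W_div) − W` LIVE.**  For ANY family as in V2's
`ne2PlusOperator_v1` ([B6] carriers, uniform (2.61), `0 < η ≤ min(1, θ_i)`, `L ≥ 1`, sites of size `≥ 1`, the `U ≡ 1` layer on the forward∕backward stack with uniform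
letters, `θ_i ≤ (L^j)^{−γ}`) and ANY block-local species — words `Wc i U` (coarse), `Wf i U` (fine) with, for every `α₀ > 0` and every `Reg335 c₃₅ α₀`-regular triple `U`,
in the smallness regime `2c₃₅M_iα₀ ≤ 1`, the sup letters `≤ diagK (c_W·c₃₅M_iα₀)` and the fit letter `𝔇(Wf i U, Wc i U) ≤ diagK (c_W·c₃₅M_iα₀·θ_i)` (`c_W ≥ 0`) —: the
instances `v1Instance` with the families
`vWFamily4` satisfy `NE2PlusOperator c₃₅`, with `M₅ = 1`, `a₀ = (2·gVWc35·(βc_r + 1))⁻¹`, `B₀ = bgConst + bgConst1 + 1`, `δ₀ = δ − σ`.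
[cite: Balaban1985BackgroundPropagators, Thm 3.1 p.397 (quantifier template); (3.35) p.396, (3.42) + (3.44) p.397, (3.52) p.400, (3.59)–(3.65) pp.402–403 (shapes, mechanism)] -/
theorem ne2PlusOperator_vW (c35 : ℝ) (hc35 : 0 < c35)
    (Wc : ∀ i, (J → X' i → 𝔄) × (J → X' i → 𝔄) × (X' i → 𝔄) → ((X i × ι → ℝ) →ₗ[ℝ] (X i × ι → ℝ)))
    (Wf : ∀ i, (J → X' i → 𝔄) × (J → X' i → 𝔄) × (X' i → 𝔄) → ((X' i × ι → ℝ) →ₗ[ℝ] (X' i × ι → ℝ)))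
    (htri : ∀ i, Triangle254 (g i)) (hd : ∀ i (a b : (g i).Site), 0 ≤ (g i).dist a b) {σ cr : ℝ} (hσ : 0 ≤ σ) (hcr : 0 ≤ cr)
    (hrow : ∀ i, RowSum (g i) σ cr) (hη : ∀ i, 0 < (g i).eta) (hη1 : ∀ i, (g i).eta ≤ 1) (hηθ : ∀ i, (g i).eta ≤ θ i) (hL : ∀ i, 1 ≤ (g i).L)
    (hlen : ∀ i y, 1 ≤ (g i).len y) {δ β m₀ γ cW : ℝ} (hσδ : σ < δ) (hβ : 0 ≤ β) (hm₀ : 0 ≤ m₀) (hγ : 0 < γ) (hθγ : ∀ i y, θ i ≤ rateWeight (g i) γ y)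
    (hcW : 0 ≤ cW)
    (hWc : ∀ i (α₀ : ℝ) U, 0 < α₀ → 2 * (c35 * ((g i).M * α₀)) ≤ 1 → (v1Bg 𝔄 J (π i) (g i).M (θ i)).Reg335 c35 α₀ U →
      HasMaj (BlockNorm.ofBlocks (g i) (liftBlk (blk i) ι)) (BlockNorm.ofBlocks (g i) (liftBlk (blk i) ι)) (Wc i U) (diagK fun _ => cW * (c35 * (g i).M * α₀)))
    (hWf : ∀ i (α₀ : ℝ) U, 0 < α₀ → 2 * (c35 * ((g i).M * α₀)) ≤ 1 → (v1Bg 𝔄 J (π i) (g i).M (θ i)).Reg335 c35 α₀ U →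
      HasMaj (BlockNorm.ofBlocks (g i) (liftBlk (blk i ∘ π i) ι)) (BlockNorm.ofBlocks (g i) (liftBlk (blk i ∘ π i) ι)) (Wf i U)
        (diagK fun _ => cW * (c35 * (g i).M * α₀)))
    (hDW : ∀ i (α₀ : ℝ) U, 0 < α₀ → 2 * (c35 * ((g i).M * α₀)) ≤ 1 → (v1Bg 𝔄 J (π i) (g i).M (θ i)).Reg335 c35 α₀ U →
      HasMaj (BlockNorm.ofBlocks (g i) (liftBlk (blk i) ι)) (BlockNorm.ofBlocks (g i) (liftBlk (blk i ∘ π i) ι))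
        (idef (pull (liftMap (π i) ι)) (pull (liftMap (π i) ι)) (Wf i U) (Wc i U)) (diagK fun _ => cW * (c35 * (g i).M * α₀) * θ i))
    (hG : ∀ i, HasMaj (BlockNorm.ofBlocks (g i) (liftBlk (blk i) ι)) (BlockNorm.ofBlocks (g i) (liftBlk (blk i) ι)) (G i)
      (fun y y' => β * Real.exp (-(δ * (g i).dist y y'))))
    (hD : ∀ i μ, HasMaj (BlockNorm.ofBlocks (g i) (liftBlk (blk i) ι)) (BlockNorm.ofBlocks (g i) (liftBlk (blk i) ι)) (D i μ)
      (fun y y' => β * Real.exp (-(δ * (g i).dist y y'))))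
    (hG' : ∀ i, HasMaj (BlockNorm.ofBlocks (g i) (liftBlk (blk i ∘ π i) ι)) (BlockNorm.ofBlocks (g i) (liftBlk (blk i ∘ π i) ι)) (G' i)
      (fun y y' => β * Real.exp (-(δ * (g i).dist y y'))))
    (hD' : ∀ i μ, HasMaj (BlockNorm.ofBlocks (g i) (liftBlk (blk i ∘ π i) ι)) (BlockNorm.ofBlocks (g i) (liftBlk (blk i ∘ π i) ι)) (D' i μ)
      (fun y y' => β * Real.exp (-(δ * (g i).dist y y'))))
    (hS : ∀ i, HasMaj (BlockNorm.ofBlocks (g i) (liftBlk (blk i) ι)) (BlockNorm.ofBlocks (g i) (liftBlk (blk i) ι)) (S i)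
      (fun y y' => β * Real.exp (-(δ * (g i).dist y y'))))
    (hSD : ∀ i μ, HasMaj (BlockNorm.ofBlocks (g i) (liftBlk (blk i) ι)) (BlockNorm.ofBlocks (g i) (liftBlk (blk i) ι)) (SD i μ)
      (fun y y' => β * Real.exp (-(δ * (g i).dist y y'))))
    (hD₃' : ∀ i, HasMaj (BlockNorm.ofBlocks (g i) (liftBlk (blk i ∘ π i) ι)) (BlockNorm.ofBlocks (g i) (liftBlk (blk i ∘ π i) ι)) (D₃' i)
      (fun y y' => β * Real.exp (-(δ * (g i).dist y y'))))
    (hDG : ∀ i, HasMaj (BlockNorm.ofBlocks (g i) (liftBlk (blk i) ι)) (BlockNorm.ofBlocks (g i) (liftBlk (blk i ∘ π i) ι))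
      (idef (pull (liftMap (π i) ι)) (pull (liftMap (π i) ι)) (G' i) (G i)) (fun y y' => m₀ * θ i * Real.exp (-(δ * (g i).dist y y'))))
    (hDD : ∀ i μ, HasMaj (BlockNorm.ofBlocks (g i) (liftBlk (blk i) ι)) (BlockNorm.ofBlocks (g i) (liftBlk (blk i ∘ π i) ι))
      (idef (pull (liftMap (π i) ι)) (pull (liftMap (π i) ι)) (D' i μ) (D i μ)) (fun y y' => m₀ * θ i * Real.exp (-(δ * (g i).dist y y'))))
    (hDS : ∀ i, HasMaj (BlockNorm.ofBlocks (g i) (liftBlk (blk i) ι)) (BlockNorm.ofBlocks (g i) (liftBlk (blk i ∘ π i) ι))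
      (idef (pull (liftMap (π i) ι)) (pull (liftMap (π i) ι)) (S' i) (S i)) (fun y y' => m₀ * θ i * Real.exp (-(δ * (g i).dist y y'))))
    (hDSD : ∀ i μ, HasMaj (BlockNorm.ofBlocks (g i) (liftBlk (blk i) ι)) (BlockNorm.ofBlocks (g i) (liftBlk (blk i ∘ π i) ι))
      (idef (pull (liftMap (π i) ι)) (pull (liftMap (π i) ι)) (SD' i μ) (SD i μ)) (fun y y' => m₀ * θ i * Real.exp (-(δ * (g i).dist y y'))))
    (hDD₃ : ∀ i, HasMaj (BlockNorm.ofBlocks (g i) (liftBlk (blk i) ι)) (BlockNorm.ofBlocks (g i) (liftBlk (blk i ∘ π i) ι))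
      (idef (pull (liftMap (π i) ι)) (pull (liftMap (π i) ι)) (D₃' i) (D₃ i)) (fun y y' => m₀ * θ i * Real.exp (-(δ * (g i).dist y y')))) :
    NE2PlusOperator c35 (fun i => v1Instance 𝔄 J ι (blk i) (π i) (nsh i) (hL0 i) (θc i) (θ i))
      (fun i => vWFamily4 e (blk i) (π i) (Wc i) (Wf i) (nsh i) (hL0 i) (θc i) (θ i) (ν i) (G i) (S i) (D₃ i) (D i) (SD i) (G' i) (S' i) (D₃' i)
        (D' i) (SD' i)) := by
  obtain ⟨hcg, hgpos, _⟩ := le_gVWc35 (J := J) (basisConst_nonneg e) hc35 hcW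
  set a₀ : ℝ := (2 * gVWc35 J (basisConst e) c35 cW * (β * cr + 1))⁻¹ with ha₀_def
  have hden : 0 < 2 * gVWc35 J (basisConst e) c35 cW * (β * cr + 1) := by positivity
  have ha₀ : 0 < a₀ := inv_pos.2 hden
  have hq : β * (gVWc35 J (basisConst e) c35 cW * a₀) * cr ≤ 1 / 2 := by
    have h1 : β * (gVWc35 J (basisConst e) c35 cW * a₀) * cr = (β * cr) * (gVWc35 J (basisConst e) c35 cW * a₀) := by ring
    have h2 : gVWc35 J (basisConst e) c35 cW * a₀ = (2 * (β * cr + 1))⁻¹ := by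
      rw [ha₀_def]; field_simp
    rw [h1, h2, ← div_eq_mul_inv, div_le_iff₀ (by positivity)]
    nlinarith [mul_nonneg hβ hcr]
  have ha₀1 : 2 * (c35 * a₀) ≤ 1 := by
    have h2 : 2 * (c35 * a₀) = c35 / (gVWc35 J (basisConst e) c35 cW * (β * cr + 1)) := by
      rw [ha₀_def]; field_simp
    rw [h2, div_le_one (by positivity)]
    nlinarith [mul_nonneg hβ hcr, hgpos]
  have hC0 : 0 ≤ bgConst β cr m₀ (gVWc35 J (basisConst e) c35 cW) a₀ := bgConst_nonneg hβ hcr hm₀ hgpos.le ha₀.le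
  have hC1 : 0 ≤ bgConst1 β cr m₀ (gVWc35 J (basisConst e) c35 cW) a₀ := bgConst1_nonneg hβ hcr hm₀ hgpos.le ha₀.le
  refine ⟨1, δ - σ, a₀, bgConst β cr m₀ (gVWc35 J (basisConst e) c35 cW) a₀ + bgConst1 β cr m₀ (gVWc35 J (basisConst e) c35 cW) a₀ + 1, γ, one_pos,
    by linarith, ha₀, by linarith, hγ, fun i hM α₀ hα₀ hMα U' hreg => ?_⟩
  have hM' : 1 ≤ (g i).M := hM
  have hMα' : (g i).M * α₀ ≤ a₀ := hMα
  have hLpos : 0 < (g i).L := lt_of_lt_of_le one_pos (hL i)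
  have hη'0 : 0 ≤ (g i).eta * ((g i).L ^ nsh i)⁻¹ := mul_nonneg (hη i).le (inv_nonneg.2 (pow_nonneg hLpos.le _))
  have hη'η : (g i).eta * ((g i).L ^ nsh i)⁻¹ ≤ (g i).eta := by
    have h1 : ((g i).L ^ nsh i)⁻¹ ≤ 1 := inv_le_one_of_one_le₀ (one_le_pow₀ (hL i))
    calc (g i).eta * ((g i).L ^ nsh i)⁻¹ ≤ (g i).eta * 1 := mul_le_mul_of_nonneg_left h1 (hη i).le
      _ = (g i).eta := mul_one _
  have hθ0 : 0 ≤ θ i := (hη i).le.trans (hηθ i)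
  have hreg' : (v1Bg 𝔄 J (π i) (g i).M (θ i)).Reg335 c35 α₀ U' := hreg
  have hsm : 2 * (c35 * ((g i).M * α₀)) ≤ 1 := (mul_le_mul_of_nonneg_left (mul_le_mul_of_nonneg_left hMα' hc35.le) zero_le_two).trans ha₀1
  have key := etaRateIneq342_vWEntries e (J := J) (blk i) (π i) (B := v1Bg 𝔄 J (π i) (g i).M (θ i))
    (vWOps4 e (π i) (fun U => U) (Wc i) (Wf i) (g i).eta ((g i).eta * ((g i).L ^ nsh i)⁻¹) (ν i) (G i) (S i) (D₃ i) (D i) (SD i) (G' i) (S' i) (D₃' i)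
      (D' i) (SD' i)) U' (fun _ => rfl) (htri i) (hd i) hσ hcr (hrow i) (hη i) hLpos (hlen i) hσδ.le hβ hm₀ hθ0 (hθγ i) hc35 ha₀.le ha₀1 hq hM' hα₀
    hMα' hη'0 hη'η (hη1 i) (hηθ i) hcW (hG i) (hD i) (hG' i) (hD' i) (hS i) (hSD i) (hD₃' i) (hDG i) (hDD i) (hDS i) (hDSD i) (hDD₃ i) hreg'
    (hWc i α₀ U' hα₀ hsm hreg') (hWf i α₀ U' hα₀ hsm hreg') (hDW i α₀ U' hα₀ hsm hreg')
  intro n lam y y' hs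
  refine (key n lam y y' hs).trans ?_
  have hpref : 0 ≤ B9.pref4 ((v1Instance 𝔄 J ι (blk i) (π i) (nsh i) (hL0 i) (θc i) (θ i)).gc.len y) n := by
    have : 1 ≤ B9.pref4 ((opGeo (g i) (X i × ι) (liftBlk (blk i) ι)).len y) n := by rw [opGeo_len]; exact one_le_pref4 (hlen i y) n
    exact zero_le_one.trans this
  have hrf : 0 ≤ max (rateFactor (v1Instance 𝔄 J ι (blk i) (π i) (nsh i) (hL0 i) (θc i) (θ i)).gc γ y)
      (rateFactor (v1Instance 𝔄 J ι (blk i) (π i) (nsh i) (hL0 i) (θc i) (θ i)).gc γ y') :=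
    (T4EtaRate.rateFactor_nonneg (g := opGeo (g i) (X i × ι) (liftBlk (blk i) ι)) (hη i).le hLpos.le γ y).trans (le_max_left _ _)
  have hnorm : 0 ≤ (v1Instance 𝔄 J ι (blk i) (π i) (nsh i) (hL0 i) (θc i) (θ i)).gc.supNorm lam := Real.iSup_nonneg fun x => abs_nonneg _
  have hE : 0 ≤ Real.exp (-((δ - σ) * (v1Instance 𝔄 J ι (blk i) (π i) (nsh i) (hL0 i) (θc i) (θ i)).gc.dist y y')) := Real.exp_nonneg _
  exact mul_le_mul_of_nonneg_right (mul_le_mul_of_nonneg_right (mul_le_mul_of_nonneg_right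
    (mul_le_mul_of_nonneg_right (le_add_of_nonneg_right zero_le_one) hpref) hE) hrf) hnorm

variable (s : ∀ i, J → X i ≃ X i) (s' : ∀ i, J → X' i ≃ X' i) (Cπ : I → ℝ)

/-- **NE2⁺, OPERATOR LAYER — `T4EtaRate.NE2PlusOperator` BY NAME WITH THE GAUGE FIELD `A′` ITSELF LIVE IN THE (3.60)-SHAPED FULL PERTURBATION `V′₁(A′) − W(A′)`.**
For ANY family as in (V4)'s `ne2PlusOperator_v1G` (commuting unit shifts, `C_π(i)`-step-connected pairing fibres with `C_π(i)·η′_i ≤ C₀·θ_i`) and ANY block-local species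
— words `Wc i A′`, `Wf i A′` with the sup letters `≤ diagK (c_W·c₃₅M_iα₀)` and the fit letter `≤ diagK (c_W·c₃₅M_iα₀·θ_i)` for every `α₀ > 0` in the smallness
regime `2c₃₅M_iα₀ ≤ 1` and every `(v1GaugeBg …).Reg335 c₃₅ α₀`-regular `A′` (`c_W ≥ 0`) —: the instances `v1GaugeInstance` with the families `vWGFamily4` satisfy `NE2PlusOperator c₃₅` (inside:
`c′ = (1+|J|)(1+C₀)c₃₅`, `M₅ = 1`, `a₀ = (2·gVWc35(c′)·(βc_r + 1))⁻¹`, `B₀ = bgConst + bgConst1 + 1`, `δ₀ = δ − σ`).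
[cite: Balaban1985BackgroundPropagators, Thm 3.1 p.397 (quantifier template); (3.35)–(3.36) p.396, (3.42) p.397, (3.44) p.398, (3.52) p.400, (3.59)–(3.65) pp.402–403 (shapes, mechanism)] -/
theorem ne2PlusOperator_vWG (c35 : ℝ) (hc35 : 0 < c35)
    (Wc : ∀ i, (J → X' i → 𝔄) → ((X i × ι → ℝ) →ₗ[ℝ] (X i × ι → ℝ))) (Wf : ∀ i, (J → X' i → 𝔄) → ((X' i × ι → ℝ) →ₗ[ℝ] (X' i × ι → ℝ)))
    (htri : ∀ i, Triangle254 (g i)) (hd : ∀ i (a b : (g i).Site), 0 ≤ (g i).dist a b) {σ cr : ℝ} (hσ : 0 ≤ σ) (hcr : 0 ≤ cr)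
    (hrow : ∀ i, RowSum (g i) σ cr) (hη : ∀ i, 0 < (g i).eta) (hη1 : ∀ i, (g i).eta ≤ 1) (hηθ : ∀ i, (g i).eta ≤ θ i) (hL : ∀ i, 1 ≤ (g i).L)
    (hlen : ∀ i y, 1 ≤ (g i).len y) {δ β m₀ γ cW : ℝ} (hσδ : σ < δ) (hβ : 0 ≤ β) (hm₀ : 0 ≤ m₀) (hγ : 0 < γ) (hθγ : ∀ i y, θ i ≤ rateWeight (g i) γ y)
    (hcomm : ∀ i μ κ x, (s' i μ).symm (s' i κ x) = s' i κ ((s' i μ).symm x)) (hCπ : ∀ i, 0 ≤ Cπ i)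
    (hconn : ∀ i (f : X' i → 𝔄) (b : ℝ), (∀ κ x, ‖f (s' i κ x) - f x‖ ≤ b) → ∀ x₁ x₂, π i x₁ = π i x₂ → ‖f x₁ - f x₂‖ ≤ Cπ i * b)
    {C₀ : ℝ} (hC₀ : 0 ≤ C₀) (hCθ : ∀ i, Cπ i * ((g i).eta * ((g i).L ^ nsh i)⁻¹) ≤ C₀ * θ i) (hcW : 0 ≤ cW)
    (hWc : ∀ i (α₀ : ℝ) A', 0 < α₀ → 2 * (c35 * ((g i).M * α₀)) ≤ 1 → (v1GaugeBg 𝔄 J (s' i) ((g i).eta * ((g i).L ^ nsh i)⁻¹) (g i).M).Reg335 c35 α₀ A' →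
      HasMaj (BlockNorm.ofBlocks (g i) (liftBlk (blk i) ι)) (BlockNorm.ofBlocks (g i) (liftBlk (blk i) ι)) (Wc i A') (diagK fun _ => cW * (c35 * (g i).M * α₀)))
    (hWf : ∀ i (α₀ : ℝ) A', 0 < α₀ → 2 * (c35 * ((g i).M * α₀)) ≤ 1 → (v1GaugeBg 𝔄 J (s' i) ((g i).eta * ((g i).L ^ nsh i)⁻¹) (g i).M).Reg335 c35 α₀ A' →
      HasMaj (BlockNorm.ofBlocks (g i) (liftBlk (blk i ∘ π i) ι)) (BlockNorm.ofBlocks (g i) (liftBlk (blk i ∘ π i) ι)) (Wf i A')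
        (diagK fun _ => cW * (c35 * (g i).M * α₀)))
    (hDW : ∀ i (α₀ : ℝ) A', 0 < α₀ → 2 * (c35 * ((g i).M * α₀)) ≤ 1 → (v1GaugeBg 𝔄 J (s' i) ((g i).eta * ((g i).L ^ nsh i)⁻¹) (g i).M).Reg335 c35 α₀ A' →
      HasMaj (BlockNorm.ofBlocks (g i) (liftBlk (blk i) ι)) (BlockNorm.ofBlocks (g i) (liftBlk (blk i ∘ π i) ι))
        (idef (pull (liftMap (π i) ι)) (pull (liftMap (π i) ι)) (Wf i A') (Wc i A')) (diagK fun _ => cW * (c35 * (g i).M * α₀) * θ i))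
    (hG : ∀ i, HasMaj (BlockNorm.ofBlocks (g i) (liftBlk (blk i) ι)) (BlockNorm.ofBlocks (g i) (liftBlk (blk i) ι)) (G i)
      (fun y y' => β * Real.exp (-(δ * (g i).dist y y'))))
    (hD : ∀ i μ, HasMaj (BlockNorm.ofBlocks (g i) (liftBlk (blk i) ι)) (BlockNorm.ofBlocks (g i) (liftBlk (blk i) ι)) (D i μ)
      (fun y y' => β * Real.exp (-(δ * (g i).dist y y'))))
    (hG' : ∀ i, HasMaj (BlockNorm.ofBlocks (g i) (liftBlk (blk i ∘ π i) ι)) (BlockNorm.ofBlocks (g i) (liftBlk (blk i ∘ π i) ι)) (G' i)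
      (fun y y' => β * Real.exp (-(δ * (g i).dist y y'))))
    (hD' : ∀ i μ, HasMaj (BlockNorm.ofBlocks (g i) (liftBlk (blk i ∘ π i) ι)) (BlockNorm.ofBlocks (g i) (liftBlk (blk i ∘ π i) ι)) (D' i μ)
      (fun y y' => β * Real.exp (-(δ * (g i).dist y y'))))
    (hS : ∀ i, HasMaj (BlockNorm.ofBlocks (g i) (liftBlk (blk i) ι)) (BlockNorm.ofBlocks (g i) (liftBlk (blk i) ι)) (S i)
      (fun y y' => β * Real.exp (-(δ * (g i).dist y y'))))
    (hSD : ∀ i μ, HasMaj (BlockNorm.ofBlocks (g i) (liftBlk (blk i) ι)) (BlockNorm.ofBlocks (g i) (liftBlk (blk i) ι)) (SD i μ)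
      (fun y y' => β * Real.exp (-(δ * (g i).dist y y'))))
    (hD₃' : ∀ i, HasMaj (BlockNorm.ofBlocks (g i) (liftBlk (blk i ∘ π i) ι)) (BlockNorm.ofBlocks (g i) (liftBlk (blk i ∘ π i) ι)) (D₃' i)
      (fun y y' => β * Real.exp (-(δ * (g i).dist y y'))))
    (hDG : ∀ i, HasMaj (BlockNorm.ofBlocks (g i) (liftBlk (blk i) ι)) (BlockNorm.ofBlocks (g i) (liftBlk (blk i ∘ π i) ι))
      (idef (pull (liftMap (π i) ι)) (pull (liftMap (π i) ι)) (G' i) (G i)) (fun y y' => m₀ * θ i * Real.exp (-(δ * (g i).dist y y'))))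
    (hDD : ∀ i μ, HasMaj (BlockNorm.ofBlocks (g i) (liftBlk (blk i) ι)) (BlockNorm.ofBlocks (g i) (liftBlk (blk i ∘ π i) ι))
      (idef (pull (liftMap (π i) ι)) (pull (liftMap (π i) ι)) (D' i μ) (D i μ)) (fun y y' => m₀ * θ i * Real.exp (-(δ * (g i).dist y y'))))
    (hDS : ∀ i, HasMaj (BlockNorm.ofBlocks (g i) (liftBlk (blk i) ι)) (BlockNorm.ofBlocks (g i) (liftBlk (blk i ∘ π i) ι))
      (idef (pull (liftMap (π i) ι)) (pull (liftMap (π i) ι)) (S' i) (S i)) (fun y y' => m₀ * θ i * Real.exp (-(δ * (g i).dist y y'))))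
    (hDSD : ∀ i μ, HasMaj (BlockNorm.ofBlocks (g i) (liftBlk (blk i) ι)) (BlockNorm.ofBlocks (g i) (liftBlk (blk i ∘ π i) ι))
      (idef (pull (liftMap (π i) ι)) (pull (liftMap (π i) ι)) (SD' i μ) (SD i μ)) (fun y y' => m₀ * θ i * Real.exp (-(δ * (g i).dist y y'))))
    (hDD₃ : ∀ i, HasMaj (BlockNorm.ofBlocks (g i) (liftBlk (blk i) ι)) (BlockNorm.ofBlocks (g i) (liftBlk (blk i ∘ π i) ι))
      (idef (pull (liftMap (π i) ι)) (pull (liftMap (π i) ι)) (D₃' i) (D₃ i)) (fun y y' => m₀ * θ i * Real.exp (-(δ * (g i).dist y y')))) :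
    NE2PlusOperator c35 (fun i => v1GaugeInstance 𝔄 J ι (blk i) (π i) (s i) (s' i) (nsh i) (hL0 i))
      (fun i => vWGFamily4 e (blk i) (π i) (Wc i) (Wf i) (s i) (s' i) (nsh i) (hL0 i) (ν i) (G i) (S i) (D₃ i) (D i) (SD i) (G' i) (S' i) (D₃' i)
        (D' i) (SD' i)) := by
  -- the effective (3.35) constant of the derived triple
  have hJ0 : (0 : ℝ) ≤ Fintype.card J := Nat.cast_nonneg _
  set c' : ℝ := (1 + Fintype.card J) * (1 + C₀) * c35 with hc'
  have hc'pos : 0 < c' := by positivity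
  have hc35c' : c35 ≤ c' := by
    rw [hc']
    have h1 : (1 : ℝ) ≤ (1 + Fintype.card J) * (1 + C₀) := one_le_mul_of_one_le_of_one_le (by linarith) (by linarith)
    nlinarith
  obtain ⟨hcg, hgpos, _⟩ := le_gVWc35 (J := J) (basisConst_nonneg e) hc'pos hcW
  set a₀ : ℝ := (2 * gVWc35 J (basisConst e) c' cW * (β * cr + 1))⁻¹ with ha₀_def
  have hden : 0 < 2 * gVWc35 J (basisConst e) c' cW * (β * cr + 1) := by positivity
  have ha₀ : 0 < a₀ := inv_pos.2 hden
  have hq : β * (gVWc35 J (basisConst e) c' cW * a₀) * cr ≤ 1 / 2 := by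
    have h1 : β * (gVWc35 J (basisConst e) c' cW * a₀) * cr = (β * cr) * (gVWc35 J (basisConst e) c' cW * a₀) := by ring
    have h2 : gVWc35 J (basisConst e) c' cW * a₀ = (2 * (β * cr + 1))⁻¹ := by
      rw [ha₀_def]; field_simp
    rw [h1, h2, ← div_eq_mul_inv, div_le_iff₀ (by positivity)]
    nlinarith [mul_nonneg hβ hcr]
  have ha₀1 : 2 * (c' * a₀) ≤ 1 := by
    have h2 : 2 * (c' * a₀) = c' / (gVWc35 J (basisConst e) c' cW * (β * cr + 1)) := by
      rw [ha₀_def]; field_simp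
    rw [h2, div_le_one (by positivity)]
    nlinarith [mul_nonneg hβ hcr, hgpos]
  have hC0 : 0 ≤ bgConst β cr m₀ (gVWc35 J (basisConst e) c' cW) a₀ := bgConst_nonneg hβ hcr hm₀ hgpos.le ha₀.le
  have hC1 : 0 ≤ bgConst1 β cr m₀ (gVWc35 J (basisConst e) c' cW) a₀ := bgConst1_nonneg hβ hcr hm₀ hgpos.le ha₀.le
  refine ⟨1, δ - σ, a₀, bgConst β cr m₀ (gVWc35 J (basisConst e) c' cW) a₀ + bgConst1 β cr m₀ (gVWc35 J (basisConst e) c' cW) a₀ + 1, γ, one_pos,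
    by linarith, ha₀, by linarith, hγ, fun i hM α₀ hα₀ hMα A' hreg => ?_⟩
  have hM' : 1 ≤ (g i).M := hM
  have hMα' : (g i).M * α₀ ≤ a₀ := hMα
  have hM0 : 0 ≤ (g i).M := zero_le_one.trans hM'
  have hLpos : 0 < (g i).L := lt_of_lt_of_le one_pos (hL i)
  have hη'pos : 0 < (g i).eta * ((g i).L ^ nsh i)⁻¹ := mul_pos (hη i) (inv_pos.2 (pow_pos hLpos _))
  have hη'0 : 0 ≤ (g i).eta * ((g i).L ^ nsh i)⁻¹ := hη'pos.le
  have hη'η : (g i).eta * ((g i).L ^ nsh i)⁻¹ ≤ (g i).eta := by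
    have h1 : ((g i).L ^ nsh i)⁻¹ ≤ 1 := inv_le_one_of_one_le₀ (one_le_pow₀ (hL i))
    calc (g i).eta * ((g i).L ^ nsh i)⁻¹ ≤ (g i).eta * 1 := mul_le_mul_of_nonneg_left h1 (hη i).le
      _ = (g i).eta := mul_one _
  have hθ0 : 0 ≤ θ i := (hη i).le.trans (hηθ i)
  -- the derived triple is (3.35)-regular at `c′`
  have hr0 : 0 ≤ c35 * (g i).M * α₀ := by positivity
  have hc'le : (1 + Fintype.card J) * (c35 * (g i).M * α₀) ≤ c' * (g i).M * α₀ := by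
    rw [hc']
    have h0 : 0 ≤ (1 + Fintype.card J) * (c35 * (g i).M * α₀) := by positivity
    nlinarith [mul_nonneg hC₀ h0]
  have hθ' : (1 + Fintype.card J) * Cπ i * (c35 * (g i).M * α₀) * ((g i).eta * ((g i).L ^ nsh i)⁻¹) ≤ c' * (g i).M * α₀ * θ i := by
    have h0 : 0 ≤ (1 + Fintype.card J) * (c35 * (g i).M * α₀) := by positivity
    calc (1 + Fintype.card J) * Cπ i * (c35 * (g i).M * α₀) * ((g i).eta * ((g i).L ^ nsh i)⁻¹)
        = (1 + Fintype.card J) * (c35 * (g i).M * α₀) * (Cπ i * ((g i).eta * ((g i).L ^ nsh i)⁻¹)) := by ring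
      _ ≤ (1 + Fintype.card J) * (c35 * (g i).M * α₀) * (C₀ * θ i) := mul_le_mul_of_nonneg_left (hCθ i) h0
      _ ≤ c' * (g i).M * α₀ * θ i := by
          rw [hc']
          have : (1 + ↑(Fintype.card J)) * (c35 * (g i).M * α₀) * (C₀ * θ i) ≤ (1 + ↑(Fintype.card J)) * (c35 * (g i).M * α₀) * ((1 + C₀) * θ i) :=
            mul_le_mul_of_nonneg_left (mul_le_mul_of_nonneg_right (by linarith) hθ0) h0
          linarith
  have hregA : (v1GaugeBg 𝔄 J (s' i) ((g i).eta * ((g i).L ^ nsh i)⁻¹) (g i).M).Reg335 c35 α₀ A' := hreg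
  have hreg' : (v1Bg 𝔄 J (π i) (g i).M (θ i)).Reg335 c' α₀ (v1fieldsOfGauge 𝔄 J (s' i) ((g i).eta * ((g i).L ^ nsh i)⁻¹) A') :=
    reg335_fields_of_gauge (hcomm i) (hCπ i) (hconn i) hη'pos hr0 hc'le hθ' hregA
  -- the species letters, moved from `c₃₅` to `c′`
  have hmono : cW * (c35 * (g i).M * α₀) ≤ cW * (c' * (g i).M * α₀) :=
    mul_le_mul_of_nonneg_left (mul_le_mul_of_nonneg_right (mul_le_mul_of_nonneg_right hc35c' hM0) hα₀.le) hcW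
  have hsm : 2 * (c35 * ((g i).M * α₀)) ≤ 1 :=
    (mul_le_mul_of_nonneg_left ((mul_le_mul_of_nonneg_left hMα' hc35.le).trans (mul_le_mul_of_nonneg_right hc35c' ha₀.le)) zero_le_two).trans ha₀1
  have hWc' := (hWc i α₀ A' hα₀ hsm hregA).mono fun y y' => diagK_mono (fun _ => hmono) y y'
  have hWf' := (hWf i α₀ A' hα₀ hsm hregA).mono fun y y' => diagK_mono (fun _ => hmono) y y'
  have hDW' := (hDW i α₀ A' hα₀ hsm hregA).mono fun y y' => diagK_mono (fun _ => mul_le_mul_of_nonneg_right hmono hθ0) y y'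
  have key := etaRateIneq342_vWEntries e (J := J) (blk i) (π i) (B := v1GaugeBg 𝔄 J (s' i) ((g i).eta * ((g i).L ^ nsh i)⁻¹) (g i).M)
    (vWOps4 e (π i) (v1fieldsOfGauge 𝔄 J (s' i) ((g i).eta * ((g i).L ^ nsh i)⁻¹)) (Wc i) (Wf i) (g i).eta ((g i).eta * ((g i).L ^ nsh i)⁻¹) (ν i)
      (G i) (S i) (D₃ i) (D i) (SD i) (G' i) (S' i) (D₃' i) (D' i) (SD' i)) A' (fun _ => rfl) (htri i) (hd i) hσ hcr (hrow i) (hη i) hLpos (hlen i)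
    hσδ.le hβ hm₀ hθ0 (hθγ i) hc'pos ha₀.le ha₀1 hq hM' hα₀ hMα' hη'0 hη'η (hη1 i) (hηθ i) hcW (hG i) (hD i) (hG' i) (hD' i) (hS i) (hSD i) (hD₃' i)
    (hDG i) (hDD i) (hDS i) (hDSD i) (hDD₃ i) hreg' hWc' hWf' hDW'
  intro n lam y y' hsupp
  refine (key n lam y y' hsupp).trans ?_
  have hpref : 0 ≤ B9.pref4 ((v1GaugeInstance 𝔄 J ι (blk i) (π i) (s i) (s' i) (nsh i) (hL0 i)).gc.len y) n := by
    have : 1 ≤ B9.pref4 ((opGeo (g i) (X i × ι) (liftBlk (blk i) ι)).len y) n := by rw [opGeo_len]; exact one_le_pref4 (hlen i y) n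
    exact zero_le_one.trans this
  have hrf : 0 ≤ max (rateFactor (v1GaugeInstance 𝔄 J ι (blk i) (π i) (s i) (s' i) (nsh i) (hL0 i)).gc γ y)
      (rateFactor (v1GaugeInstance 𝔄 J ι (blk i) (π i) (s i) (s' i) (nsh i) (hL0 i)).gc γ y') :=
    (T4EtaRate.rateFactor_nonneg (g := opGeo (g i) (X i × ι) (liftBlk (blk i) ι)) (hη i).le hLpos.le γ y).trans (le_max_left _ _)
  have hnorm : 0 ≤ (v1GaugeInstance 𝔄 J ι (blk i) (π i) (s i) (s' i) (nsh i) (hL0 i)).gc.supNorm lam := Real.iSup_nonneg fun x => abs_nonneg _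
  have hE : 0 ≤ Real.exp (-((δ - σ) * (v1GaugeInstance 𝔄 J ι (blk i) (π i) (s i) (s' i) (nsh i) (hL0 i)).gc.dist y y')) := Real.exp_nonneg _
  exact mul_le_mul_of_nonneg_right (mul_le_mul_of_nonneg_right (mul_le_mul_of_nonneg_right
    (mul_le_mul_of_nonneg_right (le_add_of_nonneg_right zero_le_one) hpref) hE) hrf) hnorm

end Node

end Summit.QuantumFields.YangMills.BalabanUVNodes.N15.BackgroundLayer

end
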